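/-
Copyright (c) 2026 the pub-hodgecm-mathlib formalisation cell (harness21).  Prover seat hodgecm-mathlib-K2Liu-p01 (g6), Track B «K2-LIT»,
Road I organ (A-int)-fin, A2d∕(A4-avg) FILE 2 «geometric actions commute with the doubled group, letter by letter» (co-deal K2E5-plan (g6) 08:00:52Z ∕ 08:02:20Z).
KERNEL: theorems only.
-/
import Literature.RepresentationTheory.HeisenbergGroup.SchrodingerSymplecticGenerators   -- ★ `leviSp`, `weylSp`, `unipotentSp`, `leviEquivSB`, `unipotentEquivSB`, `weylEquivSB`, `MpPsi`
import Literature.RepresentationTheory.HeisenbergGroup.ImplementerCocycle                -- ★ `MpPsi.toRep`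
import HarnessLib

/-!
# Crux `HLiu418`, Track B road `K2_Liu`, Road I organ (A-int)-fin — FILE 2: THE GEOMETRIC (LEVI) ACTION COMMUTES WITH THE LETTERS OF THE DOUBLED GROUP

Cell `hodgecm-mathlib`, crux item hLiu418 = `stmt-HodgeConjecture-24832`, route of record `HCCMUnconditional`; squad K2 ∕ K2Liu, prover K2Liu-p01 (g6).
THEOREMS ONLY (no `def`, no instance, no notation, no named fact, no `sorry`); lane `--supports stmt-HodgeConjecture-24832 --as helper`.

The by-value binder `hcomm : ∀ γ h, Commute (s γ) (sΔ h)` of ★ `K2LiuSWSectionKPrimeAverage.exists_fixed_swSectionDelta_eq` (and of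
`swSectionDelta_toRep_eq(_mul)_of_leviEquivSB`) is discharged LETTER BY LETTER and EXACTLY (no scalar ambiguity): a pair `p₁ ∈ S̃p_ψ` acting by (a scalar multiple
of) Weil's `d₀(a) = leviEquivSB a` over `m(a, d) = leviSp a d` — e.g. `U(V′_w)` through `1_ℓ ⊗ g` (★ A2c∕A2d junction shapes, BY VALUE in `hp`, `hop`) — commutes
with a pair `p₂` over a Levi letter `m(a′, d′)`, a unipotent letter `n(b)` or a Weyl letter `w(γ, δ)` acting by (a scalar multiple of) `leviEquivSB a′`,
`unipotentEquivSB q`, `weylEquivSB γ` as soon as the GEOMETRIC conditions hold: `a, a′` and `d, d′` commute ∕ `b ∘ a = d ∘ b` and `q ∘ a = q` (`a` preserves the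
second-degree character) ∕ `a ∘ γ = γ ∘ d`, `d ∘ δ = δ ∘ a` and `a` preserves the Haar measure (`‖det a‖ = 1`, BY VALUE as `∫ g (a v) dμ = ∫ g dμ`).
* §1 function letters: `leviOp_comm`, `unipotentOp_leviOp_comm`, **`weylFun_leviOp`** (`M(Φ ∘ a⁻¹) = (MΦ) ∘ (γ d γ⁻¹)⁻¹` — change of variables + the isometry
  condition `β(a x, d y) = β(x, y)`), `weylFun_leviOp_of_conj` (`a γ = γ d` ⇒ commutation);
* §2 `𝒮`-letters: `leviEquivSB_comm`, `unipotentEquivSB_leviEquivSB_comm`, `weylEquivSB_leviEquivSB_comm`;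
* §3 `Sp`-letters: `commute_leviSp_leviSp`, `commute_leviSp_unipotentSp`, `commute_leviSp_weylSp`;
* §4 pairs: **`commute_pair_of_proj_of_toRep`** (`S̃p_ψ ≤ Sp × GL(𝒮)`: both components), `commute_of_mem_closure` (letters ⇒ the generated subgroup; Bruhat
  generation of `H_v` by `P_Δ` and `w_Δ` is NOT asserted here — it enters BY VALUE as `p ∈ Subgroup.closure T`);
* §5 **`commute_pair_levi_levi ∕ commute_pair_levi_unipotent ∕ commute_pair_levi_weyl`**: the three letter instances for pairs given BY VALUE in the ★ A2c∕A2d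
  junction shapes `proj p = leviSp∕unipotentSp∕weylSp …`, `toRep p = c • leviEquivSB∕unipotentEquivSB∕weylEquivSB …` (any smooth model `ρ` on `𝒮(X)`, e.g. ★
  `localSchrodingerDelta v`).

HONEST LABEL: HC_CM is proved only modulo the printed citations (2 remaining named inputs: hLiu418 = stmt-HodgeConjecture-24832, h413 = stmt-HodgeConjecture-24833)
until rung 0 closes; helper, closes no item.
References: [Weil1964] n° 6, n° 13; [MoeglinVignerasWaldspurger1987] Chap. 2 II.1 (A)(B), II.6; [Kudla1994] §3; [KudlaRallis1994] §1; [HarrisKudlaSweet1996] §1.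
-/

set_option autoImplicit false
set_option linter.dupNamespace false -- the mandated namespace repeats `HodgeConjecture.HodgeConjecture`
noncomputable section

open MeasureTheory Topology
open Literature.NumberTheory.Automorphic Literature.RepresentationTheory.HeisenbergGroup

namespace Summit.HodgeConjecture.HodgeConjecture.Cruxes.HLiu418.K2LiuDoublingModelGeometricActions

universe u v w

variable {R : Type u} [CommRing R] {X : Type v} {Y : Type w} [AddCommGroup X] [Module R X] [AddCommGroup Y] [Module R Y]

/-! ## §1 Function letters -/

section Functions

/-- **two commuting Levi letters give commuting operators**: `Φ ∘ a′⁻¹ ∘ a⁻¹ = Φ ∘ a⁻¹ ∘ a′⁻¹` when `a a′ = a′ a`. [cite: Weil1964, n° 13, p. 160] -/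
theorem leviOp_comm {a a' : X ≃ₗ[R] X} (h : ∀ x, a (a' x) = a' (a x)) (f : X → ℂ) :
    leviOp a (leviOp a' f) = leviOp a' (leviOp a f) := by
  funext u
  simp only [leviOp_apply]
  have key : a' (a (a'.symm (a.symm u))) = a' (a (a.symm (a'.symm u))) := by
    rw [← h, LinearEquiv.apply_symm_apply, LinearEquiv.apply_symm_apply, LinearEquiv.apply_symm_apply, LinearEquiv.apply_symm_apply]
  exact congrArg f (a.injective (a'.injective key))

/-- **a Levi letter preserving the second-degree character commutes with the unipotent letter**: `ψ(−q) · (Φ ∘ a⁻¹) = (ψ(−q) · Φ) ∘ a⁻¹` when `q ∘ a = q`.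
[cite: Weil1964, n° 13, p. 160] -/
theorem unipotentOp_leviOp_comm (ψ : AddChar R Circle) (q : X → R) (a : X ≃ₗ[R] X) (hq : ∀ u, q (a u) = q u) (f : X → ℂ) :
    unipotentOp ψ q (leviOp a f) = leviOp a (unipotentOp ψ q f) := by
  funext u
  simp only [unipotentOp_apply, leviOp_apply]
  rw [← hq (a.symm u), LinearEquiv.apply_symm_apply]

variable (β : X →ₗ[R] Y →ₗ[R] R) (ψ : AddChar R Circle) [MeasurableSpace X] (μ : Measure X) (γ : Y ≃ₗ[R] X)

/-- **THE WEYL OPERATOR AND A LEVI ISOMETRY**: for `m(a, d)` (`β(a x, d y) = β(x, y)`) with `a` preserving the Haar measure (`∫ g (a v) dμ = ∫ g dμ`, i.e.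
`‖det a‖ = 1`), `M(Φ ∘ a⁻¹) = (M Φ) ∘ (γ d γ⁻¹)⁻¹` — the change of variables `v ↦ a v` in `∫ ψ(β(v, γ⁻¹u)) Φ(a⁻¹v) dμ(v)`.
[cite: Weil1964, n° 13, p. 160] [cite: MoeglinVignerasWaldspurger1987, Chap. 2 II.6] -/
theorem weylFun_leviOp (a : X ≃ₗ[R] X) (d : Y ≃ₗ[R] Y) (had : ∀ x y, β (a x) (d y) = β x y)
    (ha : ∀ g : X → ℂ, ∫ v, g (a v) ∂μ = ∫ v, g v ∂μ) (f : X → ℂ) :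
    weylFun β ψ μ γ (leviOp a f) = leviOp ((γ.symm.trans d).trans γ) (weylFun β ψ μ γ f) := by
  funext u
  have hβ : ∀ v, β (a v) (γ.symm u) = β v (d.symm (γ.symm u)) := fun v => by
    conv_lhs => rw [← d.apply_symm_apply (γ.symm u)]
    exact had v _
  have he : γ.symm (((γ.symm.trans d).trans γ).symm u) = d.symm (γ.symm u) := by
    simp only [LinearEquiv.symm_trans_apply, LinearEquiv.symm_symm, LinearEquiv.symm_apply_apply]
  calc weylFun β ψ μ γ (leviOp a f) u = ∫ v, (ψ (β v (γ.symm u)) : ℂ) * f (a.symm v) ∂μ := rfl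
    _ = ∫ v, (ψ (β (a v) (γ.symm u)) : ℂ) * f (a.symm (a v)) ∂μ := (ha _).symm
    _ = ∫ v, (ψ (β v (d.symm (γ.symm u))) : ℂ) * f v ∂μ := by simp only [LinearEquiv.symm_apply_apply, hβ]
    _ = leviOp ((γ.symm.trans d).trans γ) (weylFun β ψ μ γ f) u := by rw [leviOp_apply, weylFun_apply, he]

/-- **… hence commutation when `a γ = γ d`** (then `γ d γ⁻¹ = a`): `M(Φ ∘ a⁻¹) = (MΦ) ∘ a⁻¹`. [cite: Weil1964, n° 13, p. 160] -/
theorem weylFun_leviOp_of_conj (a : X ≃ₗ[R] X) (d : Y ≃ₗ[R] Y) (had : ∀ x y, β (a x) (d y) = β x y) (hconj : ∀ y, a (γ y) = γ (d y))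
    (ha : ∀ g : X → ℂ, ∫ v, g (a v) ∂μ = ∫ v, g v ∂μ) (f : X → ℂ) :
    weylFun β ψ μ γ (leviOp a f) = leviOp a (weylFun β ψ μ γ f) := by
  have he : (γ.symm.trans d).trans γ = a := LinearEquiv.ext fun x => by
    rw [LinearEquiv.trans_apply, LinearEquiv.trans_apply, ← hconj, LinearEquiv.apply_symm_apply]
  rw [weylFun_leviOp β ψ μ γ a d had ha f, he]

end Functions

/-! ## §2 `𝒮`-letters -/

section SB

variable [TopologicalSpace X] [TopologicalSpace R]

omit [TopologicalSpace R] in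
/-- `𝒮`-form of `leviOp_comm`. [cite: Weil1964, n° 13, p. 160] -/
theorem leviEquivSB_comm {a a' : X ≃ₗ[R] X} (ha : Continuous a) (ha₂ : Continuous a.symm) (ha' : Continuous a') (ha'₂ : Continuous a'.symm)
    (h : ∀ x, a (a' x) = a' (a x)) (f : SchwartzBruhat X) :
    leviEquivSB a ha ha₂ (leviEquivSB a' ha' ha'₂ f) = leviEquivSB a' ha' ha'₂ (leviEquivSB a ha ha₂ f) :=
  Subtype.ext (by simp only [coe_leviEquivSB]; exact leviOp_comm h _)

/-- `𝒮`-form of `unipotentOp_leviOp_comm`. [cite: Weil1964, n° 13, p. 160] -/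
theorem unipotentEquivSB_leviEquivSB_comm [ContinuousNeg R] (ψ : AddChar R Circle) (hψ : IsLocallyConstant (⇑ψ : R → Circle)) (q : X → R)
    (hq : Continuous q) (a : X ≃ₗ[R] X) (ha : Continuous a) (ha₂ : Continuous a.symm) (hqa : ∀ u, q (a u) = q u) (f : SchwartzBruhat X) :
    unipotentEquivSB ψ hψ q hq (leviEquivSB a ha ha₂ f) = leviEquivSB a ha ha₂ (unipotentEquivSB ψ hψ q hq f) :=
  Subtype.ext (by simp only [coe_unipotentEquivSB, coe_leviEquivSB]; exact unipotentOp_leviOp_comm ψ q a hqa _)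

variable (β : X →ₗ[R] Y →ₗ[R] R) (ψ : AddChar R Circle) [MeasurableSpace X] (μ : Measure X) [OpensMeasurableSpace X]
  [IsFiniteMeasureOnCompacts μ] [IsTopologicalAddGroup X] (γ : Y ≃ₗ[R] X)

/-- `𝒮`-form of `weylFun_leviOp_of_conj`: the Weyl operator commutes with a Haar-preserving Levi isometry `m(a, d)`, `a γ = γ d`.
[cite: Weil1964, n° 13, p. 160] [cite: MoeglinVignerasWaldspurger1987, Chap. 2 II.6] -/
theorem weylEquivSB_leviEquivSB_comm (hψ : IsLocallyConstant (⇑ψ : R → Circle)) (hβ : ∀ w : Y, Continuous fun v : X => β v w)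
    (hW : ∀ f : SchwartzBruhat X, weylFun β ψ μ γ f ∈ SchwartzBruhat X) (c : ℂˣ)
    (hinv : ∀ f : SchwartzBruhat X, weylFun β ψ μ γ (weylFun β ψ μ γ f) = (c : ℂ) • fun u => (f : X → ℂ) (-u))
    (a : X ≃ₗ[R] X) (ha₁ : Continuous a) (ha₂ : Continuous a.symm) (d : Y ≃ₗ[R] Y) (had : ∀ x y, β (a x) (d y) = β x y)
    (hconj : ∀ y, a (γ y) = γ (d y)) (ha : ∀ g : X → ℂ, ∫ v, g (a v) ∂μ = ∫ v, g v ∂μ) (f : SchwartzBruhat X) :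
    weylEquivSB β ψ μ γ hψ hβ hW c hinv (leviEquivSB a ha₁ ha₂ f) = leviEquivSB a ha₁ ha₂ (weylEquivSB β ψ μ γ hψ hβ hW c hinv f) :=
  Subtype.ext (by simp only [coe_weylEquivSB, coe_leviEquivSB]; exact weylFun_leviOp_of_conj β ψ μ γ a d had hconj ha _)

end SB

/-! ## §3 `Sp`-letters -/

section Sp

variable (β : X →ₗ[R] Y →ₗ[R] R)

/-- `m(a, d)` and `m(a′, d′)` commute when `a a′ = a′ a` and `d d′ = d′ d`. [cite: Weil1964, n° 6, p. 151] -/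
theorem commute_leviSp_leviSp (a a' : X ≃ₗ[R] X) (d d' : Y ≃ₗ[R] Y) (had : ∀ x y, β (a x) (d y) = β x y) (had' : ∀ x y, β (a' x) (d' y) = β x y)
    (h₁ : ∀ x, a (a' x) = a' (a x)) (h₂ : ∀ y, d (d' y) = d' (d y)) : Commute (leviSp β a d had) (leviSp β a' d' had') := by
  refine Subtype.ext (LinearEquiv.ext fun p => ?_)
  simp only [Subgroup.coe_mul, LinearEquiv.mul_apply, coe_leviSp_apply, h₁, h₂]

variable [Invertible (2 : R)]

/-- `m(a, d)` and `n(b)` commute when `b ∘ a = d ∘ b` (`m(a,d) n(b) m(a,d)⁻¹ = n(d b a⁻¹)`). [cite: Weil1964, n° 6, p. 151] -/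
theorem commute_leviSp_unipotentSp (a : X ≃ₗ[R] X) (d : Y ≃ₗ[R] Y) (had : ∀ x y, β (a x) (d y) = β x y) (b : X →ₗ[R] Y)
    (hb : ∀ x x', β x (b x') = β x' (b x)) (h : ∀ x, b (a x) = d (b x)) : Commute (leviSp β a d had) (unipotentSp β b hb) := by
  refine Subtype.ext (LinearEquiv.ext fun p => ?_)
  simp only [Subgroup.coe_mul, LinearEquiv.mul_apply, coe_leviSp_apply, coe_unipotentSp, unipotentσ_apply, map_add, h]

omit [Invertible (2 : R)] in
/-- `m(a, d)` and `w(γ, δ)` commute when `a γ = γ d` and `d δ = δ a`. [cite: Weil1964, n° 6, p. 151] -/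
theorem commute_leviSp_weylSp (a : X ≃ₗ[R] X) (d : Y ≃ₗ[R] Y) (had : ∀ x y, β (a x) (d y) = β x y) (γ : Y ≃ₗ[R] X) (δ : X ≃ₗ[R] Y)
    (hγδ : ∀ (x : X) (y : Y), β (γ y) (δ x) = -β x y) (h₁ : ∀ y, a (γ y) = γ (d y)) (h₂ : ∀ x, d (δ x) = δ (a x)) :
    Commute (leviSp β a d had) (weylSp β γ δ hγδ) := by
  refine Subtype.ext (LinearEquiv.ext fun p => ?_)
  simp only [Subgroup.coe_mul, LinearEquiv.mul_apply, coe_leviSp_apply, coe_weylSp, weylσ_apply, h₁, h₂]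

end Sp

/-! ## §4 Pairs of `S̃p_ψ` -/

section Pairs

variable [Invertible (2 : R)] {V : Type*} [AddCommGroup V] [Module R V] {B : V →ₗ[R] V →ₗ[R] R}
  {k : Type*} [Field k] {S : Type*} [AddCommGroup S] [Module k S] (ρ : Representation k (Heisenberg B) S)

/-- **two pairs commute iff their `Sp`-components and their operators do** (`S̃p_ψ ≤ Sp(W) × GL(S)`). [cite: MoeglinVignerasWaldspurger1987, Chap. 2 II.1 (B)] -/
theorem commute_pair_of_proj_of_toRep (p₁ p₂ : MpPsi ρ) (h1 : Commute (MpPsi.proj ρ p₁) (MpPsi.proj ρ p₂))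
    (h2 : ∀ f : S, MpPsi.toRep ρ p₁ (MpPsi.toRep ρ p₂ f) = MpPsi.toRep ρ p₂ (MpPsi.toRep ρ p₁ f)) : Commute p₁ p₂ := by
  refine Subtype.ext (Prod.ext ?_ (LinearEquiv.ext fun f => ?_))
  · simpa only [Subgroup.coe_mul, Prod.fst_mul, MpPsi.proj_apply] using h1.eq
  · simpa only [Subgroup.coe_mul, Prod.snd_mul, LinearEquiv.mul_apply, MpPsi.toRep_apply] using h2 f

omit [Invertible (2 : R)] [AddCommGroup V] [Module R V] [Field k] [AddCommGroup S] [Module k S] in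
/-- **letters suffice**: an element commuting with a set of letters commutes with the subgroup they generate (Mathlib's centralizer).  Bruhat generation of the doubled
group by `P_Δ` and `w_Δ` is supplied BY VALUE as membership in the closure. [cite: MoeglinVignerasWaldspurger1987, Chap. 2 II.1 (B)] -/
theorem commute_of_mem_closure {G : Type*} [Group G] {T : Set G} {q p : G} (hp : p ∈ Subgroup.closure T) (h : ∀ t ∈ T, Commute q t) :
    Commute q p := by
  have hle : Subgroup.closure T ≤ Subgroup.centralizer {q} :=
    (Subgroup.closure_le _).2 fun t ht => Subgroup.mem_centralizer_iff.2 fun g hg => by rw [Set.mem_singleton_iff.1 hg]; exact (h t ht).eq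
  exact Subgroup.mem_centralizer_iff.1 (hle hp) q (Set.mem_singleton q)

end Pairs

/-! ## §5 The three letter instances for pairs over a smooth model on `𝒮(X)` -/

section Letters

variable [Invertible (2 : R)] [TopologicalSpace X] [TopologicalSpace R] (β : X →ₗ[R] Y →ₗ[R] R)
  (ρ : Representation ℂ (Heisenberg (polar β)) (SchwartzBruhat X))

omit [TopologicalSpace R] in
/-- **LEVI vs LEVI**: pairs `p₁` over `m(a, d)` acting by `c₁ • leviEquivSB a` and `p₂` over `m(a′, d′)` acting by `c₂ • leviEquivSB a′` commute when `a, a′` and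
`d, d′` commute — e.g. `1_ℓ ⊗ g` (`g ∈ U(V′_w)`) against the Siegel Levi `a ⊗ 1`. [cite: MoeglinVignerasWaldspurger1987, Chap. 2 II.1, II.6] [cite: Kudla1994, §3] -/
theorem commute_pair_levi_levi (p₁ p₂ : MpPsi ρ) (a a' : X ≃ₗ[R] X) (d d' : Y ≃ₗ[R] Y)
    (had : ∀ x y, β (a x) (d y) = β x y) (had' : ∀ x y, β (a' x) (d' y) = β x y)
    (hp₁ : MpPsi.proj ρ p₁ = leviSp β a d had) (hp₂ : MpPsi.proj ρ p₂ = leviSp β a' d' had')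
    (ha : Continuous a) (ha₂ : Continuous a.symm) (ha' : Continuous a') (ha'₂ : Continuous a'.symm) (c₁ c₂ : ℂ)
    (hop₁ : ∀ f, MpPsi.toRep ρ p₁ f = c₁ • leviEquivSB a ha ha₂ f) (hop₂ : ∀ f, MpPsi.toRep ρ p₂ f = c₂ • leviEquivSB a' ha' ha'₂ f)
    (h₁ : ∀ x, a (a' x) = a' (a x)) (h₂ : ∀ y, d (d' y) = d' (d y)) : Commute p₁ p₂ := by
  refine commute_pair_of_proj_of_toRep ρ p₁ p₂ (by rw [hp₁, hp₂]; exact commute_leviSp_leviSp β a a' d d' had had' h₁ h₂) fun f => ?_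
  rw [hop₂, hop₁, hop₁, hop₂, map_smul, map_smul, smul_comm, leviEquivSB_comm ha ha₂ ha' ha'₂ h₁]

/-- **LEVI vs UNIPOTENT**: `p₁` over `m(a, d)` acting by `c₁ • leviEquivSB a` and `p₂` over `n(b)` acting by `c₂ • unipotentEquivSB q` commute when `b a = d b`
and `q ∘ a = q` — e.g. `1_ℓ ⊗ g` against the Siegel unipotent `n(b)` (`g` isometric: `q_b((1⊗g)x) = q_b(x)`). [cite: MoeglinVignerasWaldspurger1987, Chap. 2 II.1, II.6] -/
theorem commute_pair_levi_unipotent [ContinuousNeg R] (ψ : AddChar R Circle) (hψ : IsLocallyConstant (⇑ψ : R → Circle)) (p₁ p₂ : MpPsi ρ)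
    (a : X ≃ₗ[R] X) (d : Y ≃ₗ[R] Y) (had : ∀ x y, β (a x) (d y) = β x y) (b : X →ₗ[R] Y) (hb : ∀ x x', β x (b x') = β x' (b x))
    (hp₁ : MpPsi.proj ρ p₁ = leviSp β a d had) (hp₂ : MpPsi.proj ρ p₂ = unipotentSp β b hb)
    (ha : Continuous a) (ha₂ : Continuous a.symm) (q : X → R) (hq : Continuous q) (c₁ c₂ : ℂ)
    (hop₁ : ∀ f, MpPsi.toRep ρ p₁ f = c₁ • leviEquivSB a ha ha₂ f) (hop₂ : ∀ f, MpPsi.toRep ρ p₂ f = c₂ • unipotentEquivSB ψ hψ q hq f)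
    (hgeo : ∀ x, b (a x) = d (b x)) (hqa : ∀ u, q (a u) = q u) : Commute p₁ p₂ := by
  refine commute_pair_of_proj_of_toRep ρ p₁ p₂ (by rw [hp₁, hp₂]; exact commute_leviSp_unipotentSp β a d had b hb hgeo) fun f => ?_
  rw [hop₂, hop₁, hop₁, hop₂, map_smul, map_smul, smul_comm, unipotentEquivSB_leviEquivSB_comm ψ hψ q hq a ha ha₂ hqa]

variable [MeasurableSpace X] (μ : Measure X) [OpensMeasurableSpace X] [IsFiniteMeasureOnCompacts μ] [IsTopologicalAddGroup X]

/-- **LEVI vs WEYL**: `p₁` over `m(a, d)` acting by `c₁ • leviEquivSB a` and `p₂` over `w(γ, δ)` acting by `c₂ • weylEquivSB γ` commute when `a γ = γ d`,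
`d δ = δ a` and `a` preserves the Haar measure — e.g. `1_ℓ ⊗ g` (isometry, `‖det‖ = 1`) against `w_Δ = w(id, id)` of ★ A2d-3.
[cite: MoeglinVignerasWaldspurger1987, Chap. 2 II.1, II.6] [cite: Weil1964, n° 13] -/
theorem commute_pair_levi_weyl (ψ : AddChar R Circle) (hψ : IsLocallyConstant (⇑ψ : R → Circle)) (hβ : ∀ w : Y, Continuous fun v : X => β v w)
    (γ : Y ≃ₗ[R] X) (δ : X ≃ₗ[R] Y) (hγδ : ∀ (x : X) (y : Y), β (γ y) (δ x) = -β x y)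
    (hW : ∀ f : SchwartzBruhat X, weylFun β ψ μ γ f ∈ SchwartzBruhat X) (c : ℂˣ)
    (hinv : ∀ f : SchwartzBruhat X, weylFun β ψ μ γ (weylFun β ψ μ γ f) = (c : ℂ) • fun u => (f : X → ℂ) (-u))
    (p₁ p₂ : MpPsi ρ) (a : X ≃ₗ[R] X) (d : Y ≃ₗ[R] Y) (had : ∀ x y, β (a x) (d y) = β x y)
    (hp₁ : MpPsi.proj ρ p₁ = leviSp β a d had) (hp₂ : MpPsi.proj ρ p₂ = weylSp β γ δ hγδ)
    (ha₁ : Continuous a) (ha₂ : Continuous a.symm) (c₁ c₂ : ℂ)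
    (hop₁ : ∀ f, MpPsi.toRep ρ p₁ f = c₁ • leviEquivSB a ha₁ ha₂ f) (hop₂ : ∀ f, MpPsi.toRep ρ p₂ f = c₂ • weylEquivSB β ψ μ γ hψ hβ hW c hinv f)
    (h₁ : ∀ y, a (γ y) = γ (d y)) (h₂ : ∀ x, d (δ x) = δ (a x)) (ha : ∀ g : X → ℂ, ∫ v, g (a v) ∂μ = ∫ v, g v ∂μ) : Commute p₁ p₂ := by
  refine commute_pair_of_proj_of_toRep ρ p₁ p₂ (by rw [hp₁, hp₂]; exact commute_leviSp_weylSp β a d had γ δ hγδ h₁ h₂) fun f => ?_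
  rw [hop₂, hop₁, hop₁, hop₂, map_smul, map_smul, smul_comm, weylEquivSB_leviEquivSB_comm β ψ μ γ hψ hβ hW c hinv a ha₁ ha₂ d had h₁ ha]

end Letters

end Summit.HodgeConjecture.HodgeConjecture.Cruxes.HLiu418.K2LiuDoublingModelGeometricActions
end
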